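import Mathlib
import HarnessLib
import Summits.ABC.ABC.Theses.IsogenyGlueCongruence
import Literature.NumberTheory.EllipticCurves.Szpiro

/-!
Scratch for crux-ideate `stmt-ABC-10895` (`SharpDegreeOfPolyDegree`), ideator 2, round 1.
First lemmas of the idea cards `totient-level-ledger` and `euclidean-stratum-eds`;
statements only (`sorry` allowed: this is the ideator's scratch file, not a proposal).
-/

noncomputable section

set_option linter.dupNamespace false

open scoped Classical

namespace Summit.ABC.ABC.Cruxes.SharpDegreeOfPolyDegree.Ideate2

open Summit.ABC.ABC.Theses.IsogenyGlueCongruence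

/-! ### The height dictionary (shared by both cards) -/

/-- Polynomial Lang–Szpiro for semistable curves: `max(|Δ_min|, |c₄|³) ≤ C · N^K`
(shape of `Literature.NumberTheory.EllipticCurves.GeneralizedSzpiroConjectureBG`, exponent free,
restricted to semistable curves). -/
def PolyLangSzpiroSS : Prop :=
  ∃ K C : ℝ, ∀ W₀ : WeierstrassCurve ℤ, (W₀.baseChange ℚ).IsElliptic →
    (∀ v : IsDedekindDomain.HeightOneSpectrum ℤ, (W₀.baseChange ℚ).IsMinimalAt v) →
    (W₀.baseChange ℚ).IsSemistable ℤ →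
      ((max |W₀.Δ| (|W₀.c₄| ^ 3) : ℤ) : ℝ) ≤ C * ((W₀.baseChange ℚ).conductorNorm ℤ : ℝ) ^ K

/-- Generalized (Lang–)Szpiro for semistable curves, sharp exponent `6 + ε`. -/
def GenSzpiroSS : Prop :=
  ∀ ε : ℝ, 0 < ε → ∃ C : ℝ, ∀ W₀ : WeierstrassCurve ℤ, (W₀.baseChange ℚ).IsElliptic →
    (∀ v : IsDedekindDomain.HeightOneSpectrum ℤ, (W₀.baseChange ℚ).IsMinimalAt v) →
    (W₀.baseChange ℚ).IsSemistable ℤ →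
      ((max |W₀.Δ| (|W₀.c₄| ^ 3) : ℤ) : ℝ) ≤
        C * ((W₀.baseChange ℚ).conductorNorm ℤ : ℝ) ^ (6 + ε)

/-- The antecedent of the crux (verbatim). -/
def PolyDeg : Prop :=
  ∃ κ C : ℝ, ∀ (W : WeierstrassCurve ℚ) [W.IsElliptic] [W.IsGloballyMinimal]
    [NeZero (W.conductorNorm ℤ)], W.IsSemistable ℤ →
      ∃ D : Literature.NumberTheory.EllipticCurves.ModularForms.ModularParametrizationData W
        (W.conductorNorm ℤ), (D.modularDegree : ℝ) ≤ C * (W.conductorNorm ℤ : ℝ) ^ κ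

theorem crux_iff : SharpDegreeOfPolyDegree ↔ (PolyDeg → SemistableDegreeConjecture) := Iff.rfl

/-- TRANSFER. `hdown` := Zagier's formula (proved in tree) + `c ∈ ℤ ∖ {0}` + the trivial
`(f,f) ≫ 1` and `12 h_F ≥ log max(|Δ|,|c₄|³) − O(log)`; `hup` := Silverman's archimedean
inequality + `(f,f) ≪ N^{1+ε}` (Rankin–Selberg/Hoffstein–Lockhart upper bound) + Manin constant
bounded on a semistable isogeny class. Both are fact-shaped; the crux is then `hT`. -/
theorem sharp_of_transfer (hdown : PolyDeg → PolyLangSzpiroSS)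
    (hup : GenSzpiroSS → SemistableDegreeConjecture)
    (hT : PolyLangSzpiroSS → GenSzpiroSS) : SharpDegreeOfPolyDegree := by
  intro hP
  exact hup (hT (hdown hP))

/-! ### Card `totient-level-ledger` -/

/-- A1. Exponent collapse at large primes: under `PolyLangSzpiroSS`, for every `θ > 0` there is
`B` with `v_p(Δ_min) ≤ B` whenever `p ≥ N^θ`. -/
def LargePrimeExponentBound : Prop :=
  ∀ θ : ℝ, 0 < θ → ∃ B : ℕ, ∀ W₀ : WeierstrassCurve ℤ, (W₀.baseChange ℚ).IsElliptic →
    (∀ v : IsDedekindDomain.HeightOneSpectrum ℤ, (W₀.baseChange ℚ).IsMinimalAt v) →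
    (W₀.baseChange ℚ).IsSemistable ℤ →
    ∀ p : ℕ, p.Prime → ((W₀.baseChange ℚ).conductorNorm ℤ : ℝ) ^ θ ≤ p →
      (W₀.Δ).natAbs.factorization p ≤ B

theorem largePrimeExponentBound_of_poly (h : PolyLangSzpiroSS) : LargePrimeExponentBound := by
  sorry

/-- A2. The totient ledger: `Σ_p e_p·w_p = Σ_{d ≥ 1} φ(d) · Σ_{p : d ∣ e_p} w_p` (from
`Σ_{d ∣ e} φ(d) = e`, Mathlib `Nat.sum_totient`). With `w_p = log p` the inner sums are the
"level-`d` unramified masses" `M_d` of the card. -/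
theorem totient_ledger (s : Finset ℕ) (e : ℕ → ℕ) (w : ℕ → ℝ) (B : ℕ)
    (h0 : ∀ p ∈ s, 0 < e p) (hB : ∀ p ∈ s, e p ≤ B) :
    ∑ p ∈ s, (e p : ℝ) * w p =
      ∑ d ∈ Finset.Icc 1 B, (Nat.totient d : ℝ) * ∑ p ∈ s.filter (fun p => d ∣ e p), w p := by
  -- divisors of `e p` inside the window `1 … B`
  have hdiv : ∀ p ∈ s, (Nat.divisors (e p)) = (Finset.Icc 1 B).filter (fun d => d ∣ e p) := by
    intro p hp
    ext d
    simp only [Nat.mem_divisors, Finset.mem_filter, Finset.mem_Icc]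
    constructor
    · rintro ⟨hd, hne⟩
      refine ⟨⟨Nat.pos_of_dvd_of_pos hd (h0 p hp), ?_⟩, hd⟩
      exact (Nat.le_of_dvd (h0 p hp) hd).trans (hB p hp)
    · rintro ⟨⟨-, -⟩, hd⟩
      exact ⟨hd, (h0 p hp).ne'⟩
  -- expand `e p = Σ_{d ∣ e p} φ d`
  have hexp : ∀ p ∈ s, (e p : ℝ) * w p =
      ∑ d ∈ Finset.Icc 1 B, if d ∣ e p then (Nat.totient d : ℝ) * w p else 0 := by
    intro p hp
    have hsum : (e p : ℝ) = ∑ d ∈ (e p).divisors, (Nat.totient d : ℝ) := by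
      rw [← Nat.cast_sum, Nat.sum_totient]
    rw [hsum, hdiv p hp, Finset.sum_mul, Finset.sum_filter]
  rw [Finset.sum_congr rfl hexp, Finset.sum_comm]
  refine Finset.sum_congr rfl fun d _ => ?_
  rw [Finset.mul_sum, ← Finset.sum_filter]

/-- A2'. Level-`m` truncation of the ledger: `Σ_{d ∣ m, d ∣ e} φ(d) = gcd(m, e)`. -/
theorem sum_totient_divisors_filter_dvd (m e : ℕ) (hm : 0 < m) (he : 0 < e) :
    ∑ d ∈ (Nat.divisors m).filter (fun d => d ∣ e), Nat.totient d = Nat.gcd m e := by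
  have hset : (Nat.divisors m).filter (fun d => d ∣ e) = Nat.divisors (Nat.gcd m e) := by
    ext d
    simp only [Finset.mem_filter, Nat.mem_divisors, Nat.dvd_gcd_iff]
    constructor
    · rintro ⟨⟨hdm, -⟩, hde⟩
      exact ⟨⟨hdm, hde⟩, (Nat.gcd_pos_of_pos_left e hm).ne'⟩
    · rintro ⟨⟨hdm, hde⟩, -⟩
      exact ⟨⟨hdm, hm.ne'⟩, hde⟩
  rw [hset, Nat.sum_totient]

/-- A3. The GRADED level statement `T_m`: the `gcd(m, v_p Δ)`-weighted conductor of a semistable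
curve is at most `(6+ε) log N + C`. It only sees the finite Galois module `E[m]`
(`gcd(m, e_p) = #Φ_p[m]` = unramified part of `E[m]` at `p` beyond `μ_m`). `T_6` is trivial,
Szpiro gives every `T_m`, and `T_{B!}` is all that regime F needs (A4). -/
def LevelSzpiro (m : ℕ) : Prop :=
  ∀ ε : ℝ, 0 < ε → ∃ C : ℝ, ∀ W₀ : WeierstrassCurve ℤ, (W₀.baseChange ℚ).IsElliptic →
    (∀ v : IsDedekindDomain.HeightOneSpectrum ℤ, (W₀.baseChange ℚ).IsMinimalAt v) →
    (W₀.baseChange ℚ).IsSemistable ℤ →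
      ∑ p ∈ (W₀.Δ).natAbs.primeFactors,
          (Nat.gcd m ((W₀.Δ).natAbs.factorization p) : ℝ) * Real.log p
        ≤ (6 + ε) * Real.log ((W₀.baseChange ℚ).conductorNorm ℤ : ℝ) + C

/-- `T_6` holds unconditionally (`gcd(6, e) ≤ 6` and `N = rad Δ_min` for semistable curves). -/
theorem levelSzpiro_six : LevelSzpiro 6 := by
  sorry

/-- Szpiro's conjecture gives every graded statement. -/
theorem levelSzpiro_of_szpiro (h : Literature.NumberTheory.EllipticCurves.SzpiroConjecture)
    (m : ℕ) : LevelSzpiro m := by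
  sorry

/-- A4. Regime-F reduction: under the polynomial bound, ONE graded statement `T_{B!}` yields the
sharp discriminant bound for every semistable curve whose discriminant mass on primes `< N^θ` is at
most `η log N` (loss `η`). -/
theorem regimeF_reduction (hP : PolyLangSzpiroSS) (θ η : ℝ) (hθ : 0 < θ) (hη : 0 ≤ η) :
    ∃ B : ℕ, LevelSzpiro (Nat.factorial B) → ∀ ε : ℝ, 0 < ε → ∃ C : ℝ,
      ∀ W₀ : WeierstrassCurve ℤ, (W₀.baseChange ℚ).IsElliptic →
        (∀ v : IsDedekindDomain.HeightOneSpectrum ℤ, (W₀.baseChange ℚ).IsMinimalAt v) →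
        (W₀.baseChange ℚ).IsSemistable ℤ →
        (∑ p ∈ (W₀.Δ).natAbs.primeFactors.filter
            (fun p : ℕ => ((p : ℕ) : ℝ) < ((W₀.baseChange ℚ).conductorNorm ℤ : ℝ) ^ θ),
            ((W₀.Δ).natAbs.factorization p : ℝ) * Real.log p)
          ≤ η * Real.log ((W₀.baseChange ℚ).conductorNorm ℤ : ℝ) →
        Real.log ((W₀.Δ).natAbs : ℝ)
          ≤ (6 + ε + η) * Real.log ((W₀.baseChange ℚ).conductorNorm ℤ : ℝ) + C := by
  sorry

/-! ### Card `euclidean-stratum-eds` -/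

/-- B1. The Euclidean `(2,3,6)` stratum is parametrised by rational points on sextic-twist Mordell
curves: `x³ − y² = 1728·D·z⁶` gives the point `(x/z², y/z³)` on `Y² = X³ − 1728 D`. -/
theorem mordell_point_of_sextic (x y D z : ℤ) (hz : z ≠ 0)
    (h : x ^ 3 - y ^ 2 = 1728 * D * z ^ 6) :
    ((x : ℚ) / (z : ℚ) ^ 2) ^ 3 - 1728 * (D : ℚ) = ((y : ℚ) / (z : ℚ) ^ 3) ^ 2 := by
  have hz' : (z : ℚ) ≠ 0 := by exact_mod_cast hz
  have h' : (x : ℚ) ^ 3 - (y : ℚ) ^ 2 = 1728 * (D : ℚ) * (z : ℚ) ^ 6 := by exact_mod_cast h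
  field_simp
  linear_combination h'

/-- B2. The stratum sits inside generalized Szpiro (arithmetic corollary away from `6`; the
coprimality is semistability at `p ≥ 5`). -/
theorem euclidean_corollary_of_genSzpiro
    (h : Literature.NumberTheory.EllipticCurves.GeneralizedSzpiroConjectureBG) :
    ∀ ε : ℝ, 0 < ε → ∃ C : ℝ, ∀ x y D z : ℤ, z ≠ 0 → D ≠ 0 →
      x ^ 3 - y ^ 2 = 1728 * D * z ^ 6 → Int.gcd x (D * z) = 1 →
        (|(x : ℝ)| ^ 3) ≤
          C * (UniqueFactorizationMonoid.radical (6 * D * z).natAbs : ℝ) ^ (6 + ε) := by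
  sorry

/-- B3. Radical bounds for an integer sequence, exponent `K`. -/
def RadPoly (W : ℤ → ℤ) (K : ℝ) : Prop :=
  ∃ C : ℝ, ∀ n : ℤ, W n ≠ 0 →
    (|(W n : ℝ)|) ≤ C * (UniqueFactorizationMonoid.radical (W n).natAbs : ℝ) ^ K

/-- The TOY CRUX `R_EDS`: weak-to-strong radical control along one elliptic divisibility sequence
(Mathlib `normEDS`). The Euclidean stratum of `R` for a fixed Mordell curve is this statement for
the denominator sequence of a rational point. -/
def EDSWeakToStrong : Prop :=
  ∀ b c d : ℤ, (∃ K : ℝ, RadPoly (normEDS b c d) K) →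
    ∀ ε : ℝ, 0 < ε → RadPoly (normEDS b c d) (1 + ε)

/-- Its `𝔾_m`-shadow: the same statement for `2ⁿ − 1` (Lucas sequence = EDS of the nodal cubic). -/
def MersenneWeakToStrong : Prop :=
  (∃ K C : ℝ, ∀ n : ℕ, 0 < n →
      ((2 ^ n - 1 : ℕ) : ℝ) ≤ C * (UniqueFactorizationMonoid.radical (2 ^ n - 1 : ℕ) : ℝ) ^ K) →
    ∀ ε : ℝ, 0 < ε → ∃ C : ℝ, ∀ n : ℕ, 0 < n →
      ((2 ^ n - 1 : ℕ) : ℝ) ≤ C * (UniqueFactorizationMonoid.radical (2 ^ n - 1 : ℕ) : ℝ) ^ (1 + ε)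

/-- B4. For a divisibility sequence obeying the formal-group valuation law
(`v_p(W_{r_p n}) = w_p + v_p(n)`, Silverman arXiv:math/0404412 Remark 3; Cheon–Hahn), the
"powerful excess" `log(W_n / rad W_n)` is EXACTLY the Wieferich mass
`Σ_{r_p ∣ n} (w_p − 1 + v_p(n / r_p)) log p`. So the Szpiro excess on the Euclidean stratum is a
statement about Wieferich-type primes of one sequence. -/
theorem excess_eq_wieferich_mass (W : ℕ → ℕ) (r w : ℕ → ℕ)
    (happ : ∀ p n : ℕ, p.Prime → 0 < n → (p ∣ W n ↔ r p ∣ n))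
    (hval : ∀ p n : ℕ, p.Prime → 0 < n → r p ∣ n →
      (W n).factorization p = w p + (n / r p).factorization p)
    (n : ℕ) (hn : 0 < n) (hW : W n ≠ 0) :
    Real.log (W n : ℝ) - Real.log (UniqueFactorizationMonoid.radical (W n) : ℝ) =
      ∑ p ∈ (W n).primeFactors,
        (((w p : ℝ) - 1) + ((n / r p).factorization p : ℝ)) * Real.log p := by
  sorry

end Summit.ABC.ABC.Cruxes.SharpDegreeOfPolyDegree.Ideate2

end
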